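import Summits.Schanuel.Schanuel.Theorems.ZilberEacFibreCurveZerosEdge
import Summits.Schanuel.Schanuel.Theorems.ZilberEacFibreCurveGrowthTwo
import Summits.Schanuel.Schanuel.Theorems.ZilberEacFibreCurveEdgeLemmas
import Summits.Schanuel.Schanuel.Theorems.ZilberEacFibreCurveDensity
import HarnessLib

/-!
# Logarithmic strips, VII: Zariski density for fibre curves over a graph base WITHOUT the
# leading-term condition — tilted edges and non-equimodular roots

HONEST FRAMING.  Cell `pub-schanuel` (Zilber's Exponential-Algebraic Closedness, case ladder;
host summit Schanuel), seat 2, gen 18 (HANDOFF O65).  `W = {x₁ = p(x₀), P(x₀, y₀) = 0}`,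
`deg p = d ≥ 2`, `P ∈ ℂ[x₀, y₀]` irreducible with two monomials of different `y₀`-degree.  Gen 17
proved density when `Re(lc(p)·i^d) ≠ 0`.  Here the condition is removed in two regimes, using the
second-order term of `Re p` along the zeros of `P(z, e^z)` (`τ = Re(lc(p)·i^{d-1})`,
`σ = Re(p_{d-1}·i^{d-1})`; when `Re(lc(p)·i^d) = 0`, `τ ≠ 0` automatically):
**`unprojectedDense_fibreCurveSurface_of_edge`** — for an upper supporting line `v₀ + μv₁ ≤ κ` of
the support of `P` and a nonzero root `θ` of the edge polynomial, `W` has Zariski-dense exponential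
points as soon as `μ ≠ 0` OR `dτ log|θ| + σ ≠ 0`; corollaries
**`unprojectedDense_fibreCurveSurface_of_topRight` / `_of_topLeft`** (the row of maximal
`x`-degree does not reach the extreme column on one side: a TILTED edge exists — e.g. a unique
monomial of maximal `x`-degree) and **`unprojectedDense_fibreCurveSurface_of_topRow`** (two
monomials of maximal `x`-degree and a root `θ ≠ 0` of the top-row polynomial with
`dτ log|θ| + σ ≠ 0`).  What is NOT covered (precisely): `Re(lc(p)·i^d) = 0`, the top row of the
support reaches both extreme columns, and every nonzero root of the top-row polynomial has modulus
`exp(-σ/(dτ))` — e.g. `{x₁ = -ix₀²/(2π), x₀(y₀ - 1) = 1}` (there `e^{p(z_k)} → e^{-i/π}`, a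
Schanuel/Shapiro-type question) and the constant fibres `y₀ = θ` with `|θ| = exp(-σ/(dτ))`
(not multiplicatively free).  NOT Schanuel's conjecture (neither used nor implied; EAC ⇏ SC);
`EC(3,2)` stays OPEN; classes of instances of an OPEN question (PLMS 2024, §1 p. 5).
-/

noncomputable section

open Filter Topology Set Complex MvPolynomial
open Literature.NumberTheory.Transcendental Literature.ModelTheory.Zilber
open Literature.ModelTheory.ExponentialFields

set_option linter.dupNamespace false

namespace Summit.Schanuel.Schanuel.Theorems

/-! ## Part C. Density -/

section Main

variable (p : Polynomial ℂ) {P : MvPolynomial (Fin 2) ℂ}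

/-- **THEOREM G for a fibre curve, given escaping zeros.**  `P` irreducible; zeros `z_m` of
`P(z, e^z)` with `|Re p(z_m)| / log(2 + ‖p(z_m)‖) → ∞` ⟹ `{x₁ = p(x₀), P(x₀, y₀) = 0}` has
Zariski-dense exponential points. [folklore] -/
theorem unprojectedDense_fibreCurveSurface_of_zeros (hirr : Irreducible P) (z : ℕ → ℂ)
    (hz : ∀ m, MvPolynomial.eval ![z m, exp (z m)] P = 0)
    (hgr : Tendsto (fun m => |(p.eval (z m)).re| / Real.log (2 + ‖p.eval (z m)‖)) atTop atTop) :
    UnprojectedDense {w : Fin 2 ⊕ Fin 2 → ℂ | w (Sum.inl 1) = p.eval (w (Sum.inl 0)) ∧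
      MvPolynomial.eval ![w (Sum.inl 0), w (Sum.inr 0)] P = 0} := by
  have hirr3 := irreducible_rename_castSucc₂ hirr
  rw [fibreCurveSurface_eq]
  set q : ℕ → Fin 2 ⊕ Fin 2 → ℂ := fun k =>
    Sum.elim ![z k, p.eval (z k)] ![exp (z k), exp (p.eval (z k))] with hq
  have hqS : ∀ k, q k ∈ {w : Fin 2 ⊕ Fin 2 → ℂ | w (Sum.inl 1) = p.eval (w (Sum.inl 0)) ∧
      MvPolynomial.eval ![w (Sum.inl 0), w (Sum.inr 0), w (Sum.inr 1)]
        (rename (Fin.castSucc : Fin 2 → Fin 3) P) = 0} := by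
    intro k
    refine ⟨by simp [hq], ?_⟩
    have e : (![q k (Sum.inl 0), q k (Sum.inr 0), q k (Sum.inr 1)] : Fin 3 → ℂ) =
        ![z k, exp (z k), exp (p.eval (z k))] := by
      simp [hq]
    rw [e, eval_vec3_rename_castSucc]
    exact hz k
  have hqΓ : ∀ k, q k ∈ expGraph ℂ 2 := by
    intro k
    rw [mem_expGraph_iff]
    intro i
    rw [Literature.ModelTheory.ExponentialFields.ExponentialRing.complex_exp_eq]
    fin_cases i <;> simp [hq]
  have hgr' : Tendsto (fun k => |(q k (Sum.inl 1)).re| / Real.log (2 + ‖q k (Sum.inl 1)‖))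
      atTop atTop := by
    refine hgr.congr fun k => ?_
    simp [hq]
  exact unprojectedDense_of_growth (isIrreducibleClosed_graphSurface p hirr3)
    (by rw [zariskiDim_graphSurface p hirr3]) 1 hqS hqΓ hgr'

/-- **Zariski density for fibre curves along a given edge and root** (no leading-term
condition).  `deg p = d ≥ 2`; `P ∈ ℂ[x₀, y₀]` irreducible with two monomials of different
`y₀`-degree; `v₀ + μv₁ ≤ κ` an upper supporting line of `supp P` and `θ ≠ 0` a root of the
(nonzero) edge polynomial; and `μ ≠ 0` OR `dτ log|θ| + σ ≠ 0` (`τ = Re(lc(p)·i^{d-1})`,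
`σ = Re(p_{d-1}·i^{d-1})`).  Then the exponential points of `{x₁ = p(x₀), P(x₀, y₀) = 0}` are
Zariski dense.  (If `Re(lc(p)·i^d) ≠ 0` this is gen 17's theorem; otherwise the zeros of
`P(z, e^z)` along the edge have `Re z = μ log(Im z) + log|θ| + o(1)` and the second-order growth
lemma gives the escape of `x₁ = p(z)`.)
[cite: MantovaMasser2023, §1 Further remarks, p. 5 (the question, open in general)] (new) -/
theorem unprojectedDense_fibreCurveSurface_of_edge (hd : 2 ≤ p.natDegree) (hirr : Irreducible P)
    (h1 : ∃ v ∈ P.support, ∃ v' ∈ P.support, v 1 ≠ v' 1) (μ κ : ℝ)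
    (hκ : ∀ v ∈ P.support, ((v 0 : ℕ) : ℝ) + μ * (v 1 : ℕ) ≤ κ) {θ : ℂ} (hθ0 : θ ≠ 0)
    (hθ : (∑ v ∈ P.support.filter (fun v : Fin 2 →₀ ℕ => ((v 0 : ℕ) : ℝ) + μ * (v 1 : ℕ) = κ),
        Polynomial.C (P.coeff v) * Polynomial.X ^ (v 1)).eval θ = 0)
    (hQ : (∑ v ∈ P.support.filter (fun v : Fin 2 →₀ ℕ => ((v 0 : ℕ) : ℝ) + μ * (v 1 : ℕ) = κ),
        Polynomial.C (P.coeff v) * Polynomial.X ^ (v 1)) ≠ 0)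
    (hgood : μ ≠ 0 ∨ (p.natDegree : ℝ) * (p.leadingCoeff * I ^ (p.natDegree - 1)).re *
        Real.log ‖θ‖ + (p.coeff (p.natDegree - 1) * I ^ (p.natDegree - 1)).re ≠ 0) :
    UnprojectedDense {w : Fin 2 ⊕ Fin 2 → ℂ | w (Sum.inl 1) = p.eval (w (Sum.inl 0)) ∧
      MvPolynomial.eval ![w (Sum.inl 0), w (Sum.inr 0)] P = 0} := by
  by_cases hre : (p.leadingCoeff * I ^ p.natDegree).re ≠ 0
  · exact unprojectedDense_fibreCurveSurface p (by omega) hre hirr h1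
  push Not at hre
  obtain ⟨z, hz, hIm, hRe⟩ := exists_fibreCurve_zeros_of_edge P μ κ hκ hθ0 hθ hQ
  have hp0 : p ≠ 0 := Polynomial.ne_zero_of_natDegree_gt (show 1 < p.natDegree by omega)
  -- notation
  set d : ℕ := p.natDegree with hd_def
  set τ : ℝ := (p.leadingCoeff * I ^ (d - 1)).re with hτ_def
  set σ : ℝ := (p.coeff (d - 1) * I ^ (d - 1)).re with hσ_def
  set L : ℝ := Real.log ‖θ‖ with hL_def
  -- `τ ≠ 0`: `a i^d = (a i^{d-1}) i` has zero real part, so `a i^{d-1}` is real and nonzero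
  have hτ : τ ≠ 0 := by
    have hu0 : p.leadingCoeff * I ^ (d - 1) ≠ 0 :=
      mul_ne_zero (Polynomial.leadingCoeff_ne_zero.2 hp0) (pow_ne_zero _ Complex.I_ne_zero)
    have him : (p.leadingCoeff * I ^ (d - 1)).im = 0 := by
      have e : p.leadingCoeff * I ^ d = (p.leadingCoeff * I ^ (d - 1)) * I := by
        rw [mul_assoc, ← pow_succ, Nat.sub_add_cancel (by omega : 1 ≤ d)]
      rw [e, Complex.mul_I_re] at hre
      linarith
    intro hτ0
    exact hu0 (Complex.ext (by rw [← hτ_def, hτ0]; rfl) (by rw [him]; rfl))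
  -- the strip bound `|Re z_m| ≤ |μ| log(Im z_m) + (|L| + 1)`
  have hev : ∀ᶠ m in atTop, |(z m).re - μ * Real.log ((z m).im) - L| < 1 := by
    have := (Metric.tendsto_nhds.1 hRe) 1 one_pos
    filter_upwards [this] with m hm
    rwa [Real.dist_eq] at hm
  have hy1 : ∀ᶠ m in atTop, 1 ≤ (z m).im := hIm.eventually_ge_atTop 1
  have hx : ∀ᶠ m in atTop, |(z m).re| ≤ |μ| * Real.log ((z m).im) + (|L| + 1) := by
    filter_upwards [hev, hy1] with m hm h1
    have hlog0 : 0 ≤ Real.log ((z m).im) := Real.log_nonneg h1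
    have e : (z m).re = ((z m).re - μ * Real.log ((z m).im) - L) + μ * Real.log ((z m).im) + L := by
      ring
    rw [e]
    calc |((z m).re - μ * Real.log ((z m).im) - L) + μ * Real.log ((z m).im) + L|
        ≤ |(z m).re - μ * Real.log ((z m).im) - L| + |μ * Real.log ((z m).im)| + |L| :=
          abs_add_three _ _ _
      _ ≤ 1 + |μ| * Real.log ((z m).im) + |L| := by
          rw [abs_mul, abs_of_nonneg hlog0]; linarith
      _ = |μ| * Real.log ((z m).im) + (|L| + 1) := by ring
  -- the second-order non-degeneracy, in the two regimes
  have hT : ∃ η : ℝ, 0 < η ∧ ∀ᶠ m in atTop, η ≤ |(d : ℝ) * τ * (z m).re + σ| := by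
    rcases eq_or_ne μ 0 with hμ | hμ
    · -- `μ = 0`: `Re z_m → L`, so `dτ Re z_m + σ → dτL + σ =: c₁ ≠ 0`
      have hc₁ : (d : ℝ) * τ * L + σ ≠ 0 := by
        rcases hgood with h | h
        · exact absurd hμ h
        · exact h
      have hRe' : Tendsto (fun m => (z m).re) atTop (𝓝 L) := by
        refine hRe.congr fun m => ?_
        rw [hμ, zero_mul, sub_zero]
      have hTm : Tendsto (fun m => (d : ℝ) * τ * (z m).re + σ) atTop (𝓝 ((d : ℝ) * τ * L + σ)) :=
        (hRe'.const_mul _).add_const _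
      refine ⟨|(d : ℝ) * τ * L + σ| / 2, by positivity, ?_⟩
      have := (Metric.tendsto_nhds.1 hTm) (|(d : ℝ) * τ * L + σ| / 2) (by positivity)
      filter_upwards [this] with m hm
      rw [Real.dist_eq] at hm
      have := abs_sub_abs_le_abs_sub ((d : ℝ) * τ * L + σ) ((d : ℝ) * τ * (z m).re + σ)
      rw [abs_sub_comm] at this
      linarith
    · -- `μ ≠ 0`: `|dτ Re z_m + σ| ≥ |dτμ| log(Im z_m) - |dτ|(|L| + 1) - |σ| → ∞`
      refine ⟨1, one_pos, ?_⟩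
      have hcoef : 0 < |(d : ℝ) * τ * μ| := by
        have hd0 : (d : ℝ) ≠ 0 := Nat.cast_ne_zero.2 (by omega)
        positivity
      have hlogtop : Tendsto (fun m => Real.log ((z m).im)) atTop atTop :=
        Real.tendsto_log_atTop.comp hIm
      have hbig : ∀ᶠ m in atTop, (1 + |(d : ℝ) * τ| * (|L| + 1) + |σ|) / |(d : ℝ) * τ * μ| ≤
          Real.log ((z m).im) := hlogtop.eventually_ge_atTop _
      filter_upwards [hev, hbig] with m hm hb
      set ε : ℝ := (z m).re - μ * Real.log ((z m).im) - L with hε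
      have e : (d : ℝ) * τ * (z m).re + σ =
          (d : ℝ) * τ * μ * Real.log ((z m).im) + ((d : ℝ) * τ * (L + ε) + σ) := by
        rw [hε]; ring
      rw [e]
      have h2 : |(d : ℝ) * τ * (L + ε) + σ| ≤ |(d : ℝ) * τ| * (|L| + 1) + |σ| := by
        calc |(d : ℝ) * τ * (L + ε) + σ| ≤ |(d : ℝ) * τ * (L + ε)| + |σ| := abs_add_le _ _
          _ ≤ |(d : ℝ) * τ| * (|L| + 1) + |σ| := by
              rw [abs_mul]
              refine add_le_add (mul_le_mul_of_nonneg_left ?_ (abs_nonneg _)) le_rfl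
              exact (abs_add_le _ _).trans (by linarith [hm.le])
      have hl0 : 0 ≤ Real.log ((z m).im) := le_trans (by positivity) hb
      have h3 : |(d : ℝ) * τ * μ * Real.log ((z m).im)| = |(d : ℝ) * τ * μ| * Real.log ((z m).im) := by
        rw [abs_mul, abs_of_nonneg hl0]
      have h4 : 1 + |(d : ℝ) * τ| * (|L| + 1) + |σ| ≤ |(d : ℝ) * τ * μ| * Real.log ((z m).im) := by
        rw [div_le_iff₀ hcoef] at hb; linarith
      have h5 := abs_sub_abs_le_abs_sub ((d : ℝ) * τ * μ * Real.log ((z m).im))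
        (-((d : ℝ) * τ * (L + ε) + σ))
      rw [sub_neg_eq_add, abs_neg] at h5
      linarith
  obtain ⟨η, hη, hTη⟩ := hT
  have hgr := tendsto_growth_eval_of_strip p hd hre hIm (abs_nonneg μ) hx hη hTη
  exact unprojectedDense_fibreCurveSurface_of_zeros p hirr z hz hgr

/-- **Tilted edge, leaning right ⟹ dense.**  `deg p ≥ 2`, `P` irreducible, `v₀ ∈ supp P` of
maximal `x`-degree such that every other monomial of maximal `x`-degree has smaller `y`-degree
and SOME monomial has larger `y`-degree than `v₀` (e.g. `v₀` the unique monomial of maximal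
`x`-degree and some monomial to its right).  No condition on the leading term of `p`.
[cite: MantovaMasser2023, §1 Further remarks, p. 5 (the question, open in general)] (new) -/
theorem unprojectedDense_fibreCurveSurface_of_topRight (hd : 2 ≤ p.natDegree)
    (hirr : Irreducible P) {v₀ : Fin 2 →₀ ℕ} (hv₀ : v₀ ∈ P.support)
    (htop : ∀ v ∈ P.support, v 0 ≤ v₀ 0) (hrow : ∀ v ∈ P.support, v 0 = v₀ 0 → v 1 ≤ v₀ 1)
    (hright : ∃ v ∈ P.support, v₀ 1 < v 1) :
    UnprojectedDense {w : Fin 2 ⊕ Fin 2 → ℂ | w (Sum.inl 1) = p.eval (w (Sum.inl 0)) ∧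
      MvPolynomial.eval ![w (Sum.inl 0), w (Sum.inr 0)] P = 0} := by
  obtain ⟨μ, κ, hμ, hκ, va, hva, vc, hvc, hne, hja, hjc⟩ :=
    exists_upper_edge_tilt_right P.support (fun v => v 1) (fun v => v 0) hv₀ htop hrow hright
  obtain ⟨θ, hθ0, hθ, hQ⟩ := exists_root_edgePoly hva hvc hne hja hjc
  exact unprojectedDense_fibreCurveSurface_of_edge p hd hirr ⟨va, hva, vc, hvc, hne⟩ μ κ hκ hθ0 hθ
    hQ (Or.inl hμ)

/-- **Tilted edge, leaning left ⟹ dense** (mirror image).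
[cite: MantovaMasser2023, §1 Further remarks, p. 5 (the question, open in general)] (new) -/
theorem unprojectedDense_fibreCurveSurface_of_topLeft (hd : 2 ≤ p.natDegree)
    (hirr : Irreducible P) {v₀ : Fin 2 →₀ ℕ} (hv₀ : v₀ ∈ P.support)
    (htop : ∀ v ∈ P.support, v 0 ≤ v₀ 0) (hrow : ∀ v ∈ P.support, v 0 = v₀ 0 → v₀ 1 ≤ v 1)
    (hleft : ∃ v ∈ P.support, v 1 < v₀ 1) :
    UnprojectedDense {w : Fin 2 ⊕ Fin 2 → ℂ | w (Sum.inl 1) = p.eval (w (Sum.inl 0)) ∧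
      MvPolynomial.eval ![w (Sum.inl 0), w (Sum.inr 0)] P = 0} := by
  obtain ⟨μ, κ, hμ, hκ, va, hva, vc, hvc, hne, hja, hjc⟩ :=
    exists_upper_edge_tilt_left P.support (fun v => v 1) (fun v => v 0) hv₀ htop hrow hleft
  obtain ⟨θ, hθ0, hθ, hQ⟩ := exists_root_edgePoly hva hvc hne hja hjc
  exact unprojectedDense_fibreCurveSurface_of_edge p hd hirr ⟨va, hva, vc, hvc, hne⟩ μ κ hκ hθ0 hθ
    hQ (Or.inl hμ)

/-- **Unique monomial of maximal `x`-degree ⟹ dense.**  `deg p ≥ 2`, `P` irreducible with two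
monomials of different `y₀`-degree and a UNIQUE monomial of maximal `x₀`-degree.
[cite: MantovaMasser2023, §1 Further remarks, p. 5 (the question, open in general)] (new) -/
theorem unprojectedDense_fibreCurveSurface_of_uniqueTop (hd : 2 ≤ p.natDegree)
    (hirr : Irreducible P) (h1 : ∃ v ∈ P.support, ∃ v' ∈ P.support, v 1 ≠ v' 1)
    {v₀ : Fin 2 →₀ ℕ} (hv₀ : v₀ ∈ P.support) (huniq : ∀ v ∈ P.support, v ≠ v₀ → v 0 < v₀ 0) :
    UnprojectedDense {w : Fin 2 ⊕ Fin 2 → ℂ | w (Sum.inl 1) = p.eval (w (Sum.inl 0)) ∧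
      MvPolynomial.eval ![w (Sum.inl 0), w (Sum.inr 0)] P = 0} := by
  have htop : ∀ v ∈ P.support, v 0 ≤ v₀ 0 := fun v hv => by
    by_cases h : v = v₀
    · rw [h]
    · exact (huniq v hv h).le
  have hrow : ∀ v ∈ P.support, v 0 = v₀ 0 → v = v₀ := fun v hv h => by
    by_contra hne; exact absurd h (huniq v hv hne).ne
  -- some monomial has a `y`-degree different from `v₀`'s
  obtain ⟨v, hv, v', hv', hvv'⟩ := h1
  have hex : ∃ u ∈ P.support, u 1 ≠ v₀ 1 := by
    by_cases h : v 1 = v₀ 1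
    · exact ⟨v', hv', fun h' => hvv' (h.trans h'.symm)⟩
    · exact ⟨v, hv, h⟩
  obtain ⟨u, hu, hu1⟩ := hex
  rcases lt_or_gt_of_ne hu1 with hlt | hgt
  · exact unprojectedDense_fibreCurveSurface_of_topLeft p hd hirr hv₀ htop
      (fun v hv h => (hrow v hv h).symm ▸ le_rfl) ⟨u, hu, hlt⟩
  · exact unprojectedDense_fibreCurveSurface_of_topRight p hd hirr hv₀ htop
      (fun v hv h => (hrow v hv h).symm ▸ le_rfl) ⟨u, hu, hgt⟩

/-- **Two monomials of maximal `x`-degree and a non-equimodular root ⟹ dense.**  `deg p ≥ 2`,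
`P` irreducible, `N₀` the maximal `x₀`-degree, `va, vc` monomials of `x₀`-degree `N₀` and different
`y₀`-degree, `θ ≠ 0` a root of the top-row polynomial `Q₀(y) = Σ_{v₀ = N₀} c_v y^{v₁}` with
`dτ log|θ| + σ ≠ 0`.  No condition on the leading term of `p`.
[cite: MantovaMasser2023, §1 Further remarks, p. 5 (the question, open in general)] (new) -/
theorem unprojectedDense_fibreCurveSurface_of_topRow (hd : 2 ≤ p.natDegree)
    (hirr : Irreducible P) {N₀ : ℕ} (hN : ∀ v ∈ P.support, v 0 ≤ N₀) {va vc : Fin 2 →₀ ℕ}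
    (hva : va ∈ P.support) (hvc : vc ∈ P.support) (ha0 : va 0 = N₀) (hc0 : vc 0 = N₀)
    (hne : va 1 ≠ vc 1) {θ : ℂ} (hθ0 : θ ≠ 0)
    (hθ : (∑ v ∈ P.support.filter (fun v : Fin 2 →₀ ℕ => v 0 = N₀),
        Polynomial.C (P.coeff v) * Polynomial.X ^ (v 1)).eval θ = 0)
    (hgood : (p.natDegree : ℝ) * (p.leadingCoeff * I ^ (p.natDegree - 1)).re * Real.log ‖θ‖ +
        (p.coeff (p.natDegree - 1) * I ^ (p.natDegree - 1)).re ≠ 0) :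
    UnprojectedDense {w : Fin 2 ⊕ Fin 2 → ℂ | w (Sum.inl 1) = p.eval (w (Sum.inl 0)) ∧
      MvPolynomial.eval ![w (Sum.inl 0), w (Sum.inr 0)] P = 0} := by
  have hfilt : P.support.filter (fun v : Fin 2 →₀ ℕ => ((v 0 : ℕ) : ℝ) + 0 * (v 1 : ℕ) = N₀) =
      P.support.filter (fun v : Fin 2 →₀ ℕ => v 0 = N₀) := by
    refine Finset.filter_congr fun v _ => ?_
    rw [zero_mul, add_zero]
    exact_mod_cast Iff.rfl
  have hκ : ∀ v ∈ P.support, ((v 0 : ℕ) : ℝ) + 0 * (v 1 : ℕ) ≤ N₀ := fun v hv => by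
    rw [zero_mul, add_zero]; exact_mod_cast hN v hv
  have hja : ((va 0 : ℕ) : ℝ) + 0 * (va 1 : ℕ) = N₀ := by rw [zero_mul, add_zero]; exact_mod_cast ha0
  have hjc : ((vc 0 : ℕ) : ℝ) + 0 * (vc 1 : ℕ) = N₀ := by rw [zero_mul, add_zero]; exact_mod_cast hc0
  obtain ⟨-, -, -, hQ⟩ := exists_root_edgePoly (P := P) hva hvc hne hja hjc
  refine unprojectedDense_fibreCurveSurface_of_edge p hd hirr ⟨va, hva, vc, hvc, hne⟩ 0 N₀ hκ hθ0
    ?_ hQ (Or.inr hgood)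
  rw [hfilt]; exact hθ

end Main

end Summit.Schanuel.Schanuel.Theorems
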